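import Summits.QuantumAdvantage.QuantumAdvantage.Theorems.SymplecticPurityDeqThesisKillCompose
import Summits.QuantumAdvantage.QuantumAdvantage.Theorems.SymplecticPurityDeqThesisBridge
import Summits.QuantumAdvantage.QuantumAdvantage.Theorems.SymplecticPurityDeqThesisLightFlat
import Summits.QuantumAdvantage.QuantumAdvantage.Theorems.SymplecticPurityDeqThesisOneSidedFlat
import Summits.QuantumAdvantage.QuantumAdvantage.Theorems.SymplecticPurityDeqThesisUnbalancedFlat

/-!
# Crux `DeqThesis` (stmt-QuantumAdvantage-0242), line `Sketch` — the kill, composed modulo the core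

The line's product (Cruxes/DeqThesis/Lines/Sketch.lean, `not_road_of`): the LU-dressed free-frame road
`H_LFF` (every uniform oracle-free Clifford+T family admits, at every input and stage, a layer of one-qubit
unitaries and a semantic Clifford frame in which EVERY linear cut has purity `≥ 1/(|x|^c + c)`) is FALSE,
by local flatness of the scratch-free cube family — composed here from the LANDED stubs
`stub_killCompose` (p87798), `stub_bridge` (p87072), `stub_lightFlat` (p87356), `stub_oneSidedFlat`
(p91949), `stub_unbalancedFlat`, MODULO the one open stub `stub_coreBalancedFlat` (flatness of the
normalised cube graph state against DOUBLY-BALANCED locally rotated Pauli strings: heavy Bloch mass, both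
register supports `> 3n/4`, tilt product `> 2^{7n/8}`), which enters as the hypothesis `hcore` verbatim.
`cubeLocallyFlat_of_core` is the four-way regime split (light / one-sided / unbalanced / core).
-/

set_option linter.dupNamespace false -- D-0017: single-problem summit ⇒ `QuantumAdvantage.QuantumAdvantage` by design

noncomputable section

namespace Summit.QuantumAdvantage.QuantumAdvantage.Theorems.SymplecticPurity

open Matrix Finset Literature.Computability.QuantumComplexity Literature.Computability.Cryptography

/-- **Four-way regime split**: the landed light / one-sided / unbalanced stubs and the (open) doubly-
balanced core together give local flatness of the normalised cube graph state against EVERY locally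
rotated non-identity Pauli string (`δ := min`, `n₀ := max`). -/
theorem cubeLocallyFlat_of_core
    (hcore :
    ∃ δ : ℝ, 0 < δ ∧ ∃ n₀ : ℕ, ∀ n ≥ n₀, ∀ (K : Type) [Field K] [Fintype K], Fintype.card K = 2 ^ n →
      ∀ e : K ≃+ (Fin n → ZMod 2),
      ∀ u : Fin (n + n) → Matrix Bool Bool ℂ, (∀ i, u i ∈ Matrix.unitaryGroup Bool ℂ) →
        ∀ S : Fin (n + n) → Pauli, S ≠ (fun _ => Pauli.I) →
          ((Real.sqrt 2 ^ n < ∏ i ∈ Finset.univ.filter (fun i => S i ≠ Pauli.I),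
              (∑ P ∈ ({Pauli.X, Pauli.Y, Pauli.Z} : Finset Pauli),
                ‖(P.mat * (u i * (S i).mat * star (u i))).trace‖ / 2)) ∧
            3 * n < 4 * min (Finset.univ.filter (fun i : Fin n => S (Fin.castAdd n i) ≠ Pauli.I)).card
              (Finset.univ.filter (fun j : Fin n => S (Fin.natAdd n j) ≠ Pauli.I)).card ∧
            (2 : ℝ) ^ ((7 : ℝ) / 8 * n) < ∏ k : Fin (n + n), (‖(u k * (S k).mat * star (u k)) false false‖ +
              ‖(u k * (S k).mat * star (u k)) false true‖)) →
          ‖star (fun w : QReg (n + n) =>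
                if (fun j : Fin n => w (Fin.natAdd n j)) =
                    (fun j : Fin n => decide (e ((e.symm (fun i : Fin n => if w (Fin.castAdd n i) then 1 else 0)) ^ 3) j = 1))
                then ((Real.sqrt 2 ^ n)⁻¹ : ℂ) else 0) ⬝ᵥ
              (tensorAll (fun i => u i * (S i).mat * star (u i))).mulVec
                (fun w : QReg (n + n) =>
                  if (fun j : Fin n => w (Fin.natAdd n j)) =
                      (fun j : Fin n => decide (e ((e.symm (fun i : Fin n => if w (Fin.castAdd n i) then 1 else 0)) ^ 3) j = 1))
                  then ((Real.sqrt 2 ^ n)⁻¹ : ℂ) else 0)‖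
            ≤ (2 : ℝ) ^ (-(δ * (n : ℝ))) ) :
    (∃ δ : ℝ, 0 < δ ∧ ∃ n₀ : ℕ, ∀ n ≥ n₀, ∀ (K : Type) [Field K] [Fintype K], Fintype.card K = 2 ^ n →
      ∀ e : K ≃+ (Fin n → ZMod 2),
      ∀ u : Fin (n + n) → Matrix Bool Bool ℂ, (∀ i, u i ∈ Matrix.unitaryGroup Bool ℂ) →
        ∀ S : Fin (n + n) → Pauli, S ≠ (fun _ => Pauli.I) → True →
          ‖star (fun w : QReg (n + n) =>
                if (fun j : Fin n => w (Fin.natAdd n j)) =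
                    (fun j : Fin n => decide (e ((e.symm (fun i : Fin n => if w (Fin.castAdd n i) then 1 else 0)) ^ 3) j = 1))
                then ((Real.sqrt 2 ^ n)⁻¹ : ℂ) else 0) ⬝ᵥ
              (tensorAll (fun i => u i * (S i).mat * star (u i))).mulVec
                (fun w : QReg (n + n) =>
                  if (fun j : Fin n => w (Fin.natAdd n j)) =
                      (fun j : Fin n => decide (e ((e.symm (fun i : Fin n => if w (Fin.castAdd n i) then 1 else 0)) ^ 3) j = 1))
                  then ((Real.sqrt 2 ^ n)⁻¹ : ℂ) else 0)‖
            ≤ (2 : ℝ) ^ (-(δ * (n : ℝ)))) := by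
  obtain ⟨δ₁, hδ₁, n₁, H₁⟩ := stub_lightFlat
  obtain ⟨δ₂, hδ₂, n₂, H₂⟩ := stub_oneSidedFlat
  obtain ⟨δ₄, hδ₄, n₄, H₄⟩ := stub_unbalancedFlat
  obtain ⟨δ₃, hδ₃, n₃, H₃⟩ := hcore
  refine ⟨min (min (min δ₁ δ₂) δ₃) δ₄, lt_min (lt_min (lt_min hδ₁ hδ₂) hδ₃) hδ₄,
    max (max (max n₁ n₂) n₃) n₄, fun n hn K _ _ hK e u hu S hS _ => ?_⟩
  have hmono : ∀ δ, min (min (min δ₁ δ₂) δ₃) δ₄ ≤ δ →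
      (2 : ℝ) ^ (-(δ * (n : ℝ))) ≤ (2 : ℝ) ^ (-(min (min (min δ₁ δ₂) δ₃) δ₄ * (n : ℝ))) :=
    fun δ hδ => Real.rpow_le_rpow_of_exponent_le one_le_two
      (neg_le_neg (mul_le_mul_of_nonneg_right hδ (Nat.cast_nonneg n)))
  have hn₁ : n₁ ≤ n :=
    le_trans (le_max_left _ _) (le_trans (le_max_left _ _) (le_trans (le_max_left _ _) hn))
  have hn₂ : n₂ ≤ n :=
    le_trans (le_max_right _ _) (le_trans (le_max_left _ _) (le_trans (le_max_left _ _) hn))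
  have hn₃ : n₃ ≤ n := le_trans (le_max_right _ _) (le_trans (le_max_left _ _) hn)
  have hn₄ : n₄ ≤ n := le_trans (le_max_right _ _) hn
  have hδ₁' : min (min (min δ₁ δ₂) δ₃) δ₄ ≤ δ₁ :=
    (min_le_left _ _).trans ((min_le_left _ _).trans (min_le_left _ _))
  have hδ₂' : min (min (min δ₁ δ₂) δ₃) δ₄ ≤ δ₂ :=
    (min_le_left _ _).trans ((min_le_left _ _).trans (min_le_right _ _))
  have hδ₃' : min (min (min δ₁ δ₂) δ₃) δ₄ ≤ δ₃ := (min_le_left _ _).trans (min_le_right _ _)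
  have hδ₄' : min (min (min δ₁ δ₂) δ₃) δ₄ ≤ δ₄ := min_le_right _ _
  rcases le_or_gt (∏ i ∈ Finset.univ.filter (fun i => S i ≠ Pauli.I),
      (∑ P ∈ ({Pauli.X, Pauli.Y, Pauli.Z} : Finset Pauli),
        ‖(P.mat * (u i * (S i).mat * star (u i))).trace‖ / 2)) (Real.sqrt 2 ^ n) with hL | hH
  · exact (H₁ n hn₁ K hK e u hu S hS hL).trans (hmono δ₁ hδ₁')
  rcases le_or_gt (4 * min (Finset.univ.filter (fun i : Fin n => S (Fin.castAdd n i) ≠ Pauli.I)).card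
      (Finset.univ.filter (fun j : Fin n => S (Fin.natAdd n j) ≠ Pauli.I)).card) (3 * n) with hO | hC
  · exact (H₂ n hn₂ K hK e u hu S hS hO).trans (hmono δ₂ hδ₂')
  rcases le_or_gt (∏ k : Fin (n + n), (‖(u k * (S k).mat * star (u k)) false false‖ +
      ‖(u k * (S k).mat * star (u k)) false true‖)) ((2 : ℝ) ^ ((7 : ℝ) / 8 * n)) with hU | hB
  · exact (H₄ n hn₄ K hK e u hu S hS hU).trans (hmono δ₄ hδ₄')
  · exact (H₃ n hn₃ K hK e u hu S hS ⟨hH, hC, hB⟩).trans (hmono δ₃ hδ₃')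

/-- **The kill, composed modulo the core** (`¬ H_LFF` from the doubly-balanced core alone): if the
normalised cube graph state is flat against doubly-balanced locally rotated Pauli strings, then the
LU-dressed free-frame road is false — `stub_killCompose ∘ stub_bridge ∘ cubeLocallyFlat_of_core`. -/
theorem roadLFF_false_of_coreBalancedFlat :
    (∃ δ : ℝ, 0 < δ ∧ ∃ n₀ : ℕ, ∀ n ≥ n₀, ∀ (K : Type) [Field K] [Fintype K], Fintype.card K = 2 ^ n →
      ∀ e : K ≃+ (Fin n → ZMod 2),
      ∀ u : Fin (n + n) → Matrix Bool Bool ℂ, (∀ i, u i ∈ Matrix.unitaryGroup Bool ℂ) →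
        ∀ S : Fin (n + n) → Pauli, S ≠ (fun _ => Pauli.I) →
          ((Real.sqrt 2 ^ n < ∏ i ∈ Finset.univ.filter (fun i => S i ≠ Pauli.I),
              (∑ P ∈ ({Pauli.X, Pauli.Y, Pauli.Z} : Finset Pauli),
                ‖(P.mat * (u i * (S i).mat * star (u i))).trace‖ / 2)) ∧
            3 * n < 4 * min (Finset.univ.filter (fun i : Fin n => S (Fin.castAdd n i) ≠ Pauli.I)).card
              (Finset.univ.filter (fun j : Fin n => S (Fin.natAdd n j) ≠ Pauli.I)).card ∧
            (2 : ℝ) ^ ((7 : ℝ) / 8 * n) < ∏ k : Fin (n + n), (‖(u k * (S k).mat * star (u k)) false false‖ +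
              ‖(u k * (S k).mat * star (u k)) false true‖)) →
          ‖star (fun w : QReg (n + n) =>
                if (fun j : Fin n => w (Fin.natAdd n j)) =
                    (fun j : Fin n => decide (e ((e.symm (fun i : Fin n => if w (Fin.castAdd n i) then 1 else 0)) ^ 3) j = 1))
                then ((Real.sqrt 2 ^ n)⁻¹ : ℂ) else 0) ⬝ᵥ
              (tensorAll (fun i => u i * (S i).mat * star (u i))).mulVec
                (fun w : QReg (n + n) =>
                  if (fun j : Fin n => w (Fin.natAdd n j)) =
                      (fun j : Fin n => decide (e ((e.symm (fun i : Fin n => if w (Fin.castAdd n i) then 1 else 0)) ^ 3) j = 1))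
                  then ((Real.sqrt 2 ^ n)⁻¹ : ℂ) else 0)‖
            ≤ (2 : ℝ) ^ (-(δ * (n : ℝ)))) →
    ¬ (∀ F : QCircuitFamily cliffordT, F.IsOracleFree → F.IsUniform → ∃ c : ℕ, ∀ x : List Bool, ∀ j : ℕ,
      ∃ u : Fin (x.length + F.ancillas x.length) → Matrix Bool Bool ℂ,
        (∀ i, u i ∈ Matrix.unitaryGroup Bool ℂ) ∧
        ∃ U : Matrix (QReg (x.length + F.ancillas x.length)) (QReg (x.length + F.ancillas x.length)) ℂ,
          U ∈ Matrix.unitaryGroup (QReg (x.length + F.ancillas x.length)) ℂ ∧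
          (∀ S : Fin (x.length + F.ancillas x.length) → Pauli,
            ∃ S' : Fin (x.length + F.ancillas x.length) → Pauli, ∃ c' : ℂ, ‖c'‖ = 1 ∧
              U * pauliString S * star U = c' • pauliString S') ∧
          ∀ k ≤ x.length + F.ancillas x.length,
            (1 : ℝ) / (x.length ^ c + c) ≤
              ‖puritySum k (U.mulVec ((tensorAll u).mulVec (F.stateAfter x j)))‖) :=
  fun hcore => stub_killCompose (stub_bridge (cubeLocallyFlat_of_core hcore))

end Summit.QuantumAdvantage.QuantumAdvantage.Theorems.SymplecticPurity

end
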